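import Summits.ResolutionOfSingularities.ResolutionOfSingularities.Theses.MaxContactCut
import Summits.ResolutionOfSingularities.ResolutionOfSingularities.Theorems.LocalControlClasses
import Summits.ResolutionOfSingularities.ResolutionOfSingularities.Theorems.MaxContactCutTauCut
import HarnessLib

/-!
# MaxContactCutLocalControl — kernels of the decomp-res node N46 «LocalControl / ZariskiReduction» (lens-3 g8,
  critic row 53), phase 3

By-name kernels linking the five LocalControl asides of route MaxContactCut (rev 12: `ZarZariskiReduction` R 30904,
`ZarLocalControl` LC 30905, `ZarCoherentPointwise` COHᵖ 30906, `ZarScheduling` SCHED 30907, `ZarCoherenceLift`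
LIFT 30908) to the rung they refine, `RungOne` (29273, `E 2 → E 1` of `Theorems.WeakOrderReduction`), over the
typed objects of `Theorems.LocalControlClasses` (Zariski product datum, `InFrame`, the pointed order-reduction
game `AWins`, state-assignments, forced play `IsForcedBy` / `ZWins`). Source: lens file
HOME/decomp-res-lens-3/g8/LocalControl.lean rev 2 (sha256 80bfde4c0653d098…, 440 lines, rc 0 · 0 sorry), CRITIC-LEDGER
row 53 (CLEARED AS ASIDE-RUNG MAP NODE).

LEDGER (all sorry-free below):
* R ⟸ `E 1` ⟸ `E 2 ∧ RungOne` (instantiation: the Zariski slice is a sub-family of `SeqDimFour 1 p`);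
* LC ⟸ R («a resolution is a strategy»);
* R ⟺ COHᵗ := `∃ Z, TerminatesFrom Z` EXACTLY («a terminating forced play is a weak resolution» / «the head of a
  SHORTEST weak resolution is a coherent strategy», `LocalControlClasses.exists_minimal_assignment`) — COHᵗ is R
  re-read (critic row 53), hence NOT a route item: it appears here only inside theorem statements;
* COHᵖ ⟸ COHᵗ; COHᵗ ⟸ COHᵖ ∧ SCHED (modus ponens); LIFT ⟸ COHᵖ;
* ASSEMBLY `zariskiReduction_of_pieces : LC → LIFT → SCHED → R` and the necessity ledger
  `pieces_of_zariskiReduction : R → LC ∧ COHᵗ ∧ COHᵖ ∧ LIFT` (every piece except the DECIDED `SCHED` is necessary).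
ROOT BY NAME: `closes` re-invokes `MaxContactCutTauCut.closes_tauCut` — the node is an ASIDE LADDER under 29273 /
28544 / 29781, outside the cone of the route's `closes` (NAMED-RUNG RULE). The informal content (Cossart–Piltant's
valuation-independent local control, CossartPiltant2019 Thm 1.5(i) / Thm 5.5 / Def 2.77, versus the coherence seam
they leave open on p.274) is carried by the items' docstrings in the route file.
-/

open CategoryTheory AlgebraicGeometry
open Literature.AlgebraicGeometry.Resolution
open Summit.ResolutionOfSingularities.ResolutionOfSingularities.Theses
open Summit.ResolutionOfSingularities.ResolutionOfSingularities.Theorems.WeakOrderReduction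
  (WeakAdmissible WeakResolution SeqDimFour E)
open Summit.ResolutionOfSingularities.ResolutionOfSingularities.Theorems.LocalControlClasses

namespace Summit.ResolutionOfSingularities.ResolutionOfSingularities.Theorems.MaxContactCutLocalControl

/-- COHᵗ for a fixed state-assignment `Z`: the play forced by `Z` from every Zariski-reachable datum in the frame
TERMINATES (reaches empty support). `∃ Z, TerminatesFrom Z` is the lens's `CoherentTermination`, ⟺ R exactly.
DEFINITION (support). -/
def TerminatesFrom (Z : Assignment) : Prop :=
  ∀ p : ℕ, p.Prime → ∀ (k : Type) [Field k] [CharP k p] (A : Type) [CommRing A] (f : A)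
    (s : CentreSeq (ZarAmbient A)), WeakAdmissible s (zarMarked A p f) →
    InFrame p k s.top (reachMarked A p f s).ideal →
    ∃ t : CentreSeq s.top, IsForcedBy Z t (reachMarked A p f s) ∧
      (t.transformMarked (reachMarked A p f s)).support = ∅

/-! ## R from the tree's sequence-form rungs -/

/-- **R ⟸ `SeqDimFour 1 p` for all primes** — the Zariski slice is an instance of the tree schema (class ≥ 1 is no
condition). [folklore] -/
theorem zariskiReduction_of_seqDimFour (h : ∀ p : ℕ, p.Prime → SeqDimFour 1 p) :
    MaxContactCut.ZarZariskiReduction := by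
  intro p hp k _ _ A _ f s _ hfr
  obtain ⟨g, hg1, hg2, hg3, hY, hY4, hord⟩ := hfr
  exact h p hp p hp k s.top g hg1 hg2 hg3 hY hY4 (reachMarked A p f s).ideal hord (fun y _ => Or.inl le_rfl)

/-- **R ⟸ `E 1`.** [folklore] -/
theorem zariskiReduction_of_e_one (h : E 1) : MaxContactCut.ZarZariskiReduction :=
  zariskiReduction_of_seqDimFour (fun p hp => h p hp.one_lt.le)

/-- **R ⟸ `E 2 ∧ RungOne` (29273) BY NAME.** [folklore] -/
theorem zariskiReduction_of_rungOne (h2 : E 2) (r1 : MaxContactCut.RungOne) : MaxContactCut.ZarZariskiReduction :=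
  zariskiReduction_of_e_one (r1 h2)

/-! ## The pieces from R (necessity) and R from the pieces (assembly) -/

/-- **LC ⟸ R** (a resolution is a strategy). [folklore] -/
theorem localControl_of (h : MaxContactCut.ZarZariskiReduction) : MaxContactCut.ZarLocalControl := by
  intro p hp k _ _ A _ f s hs hfr y
  obtain ⟨t, ht⟩ := h p hp k A f s hs hfr
  exact aWins_of_weakResolution t _ ht y

/-- **R ⟸ COHᵗ** (a terminating forced play is a weak resolution). [folklore] -/
theorem zariskiReduction_of_coherentTermination (h : ∃ Z : Assignment, TerminatesFrom Z) :
    MaxContactCut.ZarZariskiReduction := by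
  obtain ⟨Z, hZ⟩ := h
  intro p hp k _ _ A _ f s hs hfr
  obtain ⟨t, ht, he⟩ := hZ p hp k A f s hs hfr
  exact ⟨t, weakAdmissible_of_isForcedBy Z t _ ht, he⟩

/-- **COHᵗ ⟸ R** («the head of a shortest weak resolution is a coherent strategy»): EXACTNESS of the translation
R ⟺ COHᵗ. [folklore] -/
theorem coherentTermination_of_zariskiReduction (h : MaxContactCut.ZarZariskiReduction) :
    ∃ Z : Assignment, TerminatesFrom Z := by
  obtain ⟨Z, hZ⟩ := exists_minimal_assignment
  refine ⟨Z, ?_⟩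
  intro p hp k _ _ A _ f s hs hfr
  obtain ⟨t, ht⟩ := h p hp k A f s hs hfr
  exact hZ t.length _ t ht le_rfl

/-- **R ⟺ COHᵗ** — the certified translation at the level of strategies. [folklore] -/
theorem zariskiReduction_iff_coherentTermination :
    MaxContactCut.ZarZariskiReduction ↔ ∃ Z : Assignment, TerminatesFrom Z :=
  ⟨coherentTermination_of_zariskiReduction, zariskiReduction_of_coherentTermination⟩

/-- **COHᵖ ⟸ COHᵗ.** [folklore] -/
theorem coherentPointwise_of (h : ∃ Z : Assignment, TerminatesFrom Z) : MaxContactCut.ZarCoherentPointwise := by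
  obtain ⟨Z, hZ⟩ := h
  refine ⟨Z, ?_⟩
  intro p hp k _ _ A _ f s hs hfr y
  obtain ⟨t, ht, he⟩ := hZ p hp k A f s hs hfr
  exact zWins_of_isForcedBy Z t _ ht he y

/-- **COHᵖ ⟸ R.** [folklore] -/
theorem coherentPointwise_of_zariskiReduction (h : MaxContactCut.ZarZariskiReduction) :
    MaxContactCut.ZarCoherentPointwise :=
  coherentPointwise_of (coherentTermination_of_zariskiReduction h)

/-- **COHᵗ ⟸ COHᵖ ∧ SCHED** (scheduling, modus ponens). [folklore] -/
theorem coherentTermination_of_scheduling (hS : MaxContactCut.ZarScheduling)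
    (h : MaxContactCut.ZarCoherentPointwise) : ∃ Z : Assignment, TerminatesFrom Z := by
  obtain ⟨Z, hZ⟩ := h
  exact ⟨Z, fun p hp k _ _ A _ f s hs hfr => hS Z p hp k A f s hs hfr (hZ p hp k A f s hs hfr)⟩

/-- **LIFT ⟸ COHᵖ** (an implication is implied by its conclusion). [folklore] -/
theorem coherenceLift_of (h : MaxContactCut.ZarCoherentPointwise) : MaxContactCut.ZarCoherenceLift := fun _ => h

/-- **THE NODE'S ASSEMBLY**: local control (KNOWN mod port) ∧ coherence lift (THE SEAM) ∧ scheduling (DECIDED) ⟹ R.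
[folklore] -/
theorem zariskiReduction_of_pieces (hLC : MaxContactCut.ZarLocalControl) (hL : MaxContactCut.ZarCoherenceLift)
    (hS : MaxContactCut.ZarScheduling) : MaxContactCut.ZarZariskiReduction :=
  zariskiReduction_of_coherentTermination (coherentTermination_of_scheduling hS (hL hLC))

/-- **EXACTNESS MODULO THE DECIDED SCHEDULING**: given SCHED, R ⟺ LC ∧ LIFT. [folklore] -/
theorem zariskiReduction_iff_pieces (hS : MaxContactCut.ZarScheduling) :
    MaxContactCut.ZarZariskiReduction ↔ MaxContactCut.ZarLocalControl ∧ MaxContactCut.ZarCoherenceLift :=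
  ⟨fun h => ⟨localControl_of h, coherenceLift_of (coherentPointwise_of_zariskiReduction h)⟩,
    fun h => zariskiReduction_of_pieces h.1 h.2 hS⟩

/-- **NECESSITY LEDGER**: every piece except the decided `ZarScheduling` is implied by the rung R. [folklore] -/
theorem pieces_of_zariskiReduction (h : MaxContactCut.ZarZariskiReduction) :
    MaxContactCut.ZarLocalControl ∧ (∃ Z : Assignment, TerminatesFrom Z) ∧ MaxContactCut.ZarCoherentPointwise ∧
      MaxContactCut.ZarCoherenceLift :=
  have hT := coherentTermination_of_zariskiReduction h
  have hP := coherentPointwise_of hT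
  ⟨localControl_of h, hT, hP, coherenceLift_of hP⟩

/-- **… and from `E 2 ∧ RungOne` (29273) BY NAME.** [folklore] -/
theorem pieces_of_rungOne (h2 : E 2) (r1 : MaxContactCut.RungOne) :
    MaxContactCut.ZarZariskiReduction ∧ MaxContactCut.ZarLocalControl ∧ (∃ Z : Assignment, TerminatesFrom Z) ∧
      MaxContactCut.ZarCoherentPointwise ∧ MaxContactCut.ZarCoherenceLift :=
  have hR := zariskiReduction_of_rungOne h2 r1
  ⟨hR, pieces_of_zariskiReduction hR⟩

/-! ## ROOT BY NAME (the node is an aside ladder under 29273 / 28544 / 29781; the cone is unchanged) -/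

/-- **`closes`** — `_root_.ResolutionOfSingularities` from the MaxContactCut cruxes exactly as booked
(`Theorems.MaxContactCutTauCut.closes_tauCut`): regular roofs, pencil reduction, order bound, order-one base, the
contact and higher-τ steps, and the p-core `StepPICore` (28538), under which this node's rung lives via 28544 →
29273 (e = 1, marking = p, Zariski slice). [folklore] -/
theorem closes (hR : MaxContactCut.RegularRoofs) (hP : MaxContactCut.PencilReduction) (hB : MaxContactCut.OrderBound)
    (h1 : MaxContactCut.LocalOrderOneResolve) (hC : MaxContactCut.StepContact) (hH : MaxContactCut.StepCFHigher)
    (hI : MaxContactCut.StepPICore) : _root_.ResolutionOfSingularities :=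
  MaxContactCutTauCut.closes_tauCut hR hP hB h1 hC hH hI

end Summit.ResolutionOfSingularities.ResolutionOfSingularities.Theorems.MaxContactCutLocalControl
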